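import Mathlib
import Literature.Computability.AlgebraicComplexity.TraceGadgetMatrix
import HarnessLib

/-!
# Andrews' trace-ABP gadget (Andrews 2022, Lemma 8), II: the first-order term is `tr(XYZ)`

Topic `Literature/Computability/AlgebraicComplexity`. Continuation of `TraceGadgetMatrix.lean`
(sixth support file for `Andrews2022_thm3`). There, `det M_{[k]} = 1 + δ tr(Q B) + O(δ²)` for
the leading `k × k` corner of the gadget `M = 1 + A + δ B` with `Q = (1 + A)⁻¹ = 1 - A + A² - A³`.
Here we evaluate the trace — the weighted count of the cycle covers with exactly one feedback
edge in the printed proof: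

* `A_pow_three_apply` — `(A³)_{sᵢ,tᵢ} = cᵢ · (XYZ)ᵢᵢ` (paths `sᵢ → · → · → tᵢ` of length `3`);
* `trace_Q_mul_B` — `tr(Q B) = -Σ_{i : 3t+i < k} cᵢ (XYZ)ᵢᵢ` (only the feedback edges `tᵢ → sᵢ`
  inside the corner count; this is Andrews' `(-1)^{m+1} ε tr((X⁽¹⁾⋯X⁽ᵐ⁾)_{[k-(N-n_m)]})` for
  `m = 3`, with the rescaling `cᵢ`);
* `prod_det_M` — **Lemma 8 for `tr(XYZ)`**: for every multiset `σ` of corner sizes, if the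
  constants satisfy `#{s ∈ σ : 3t + i < s} · cᵢ = -1` (Andrews' diagonal matrix `A`, which needs
  these counts to be invertible: `σ₁ ≥ 4t` and characteristic zero in the application), then
  `∏_{s ∈ σ} det M_{[s]} = 1 + δ · tr(XYZ) + δ² · R`.

## References

* [Andrews2022] R. Andrews, *On Matrix Multiplication and Polynomial Identity Testing*, FOCS 2022,
  arXiv:2208.01078, Lemma 8 and its proof (§3).
-/

noncomputable section

open MvPolynomial Matrix

namespace Literature.Computability.AlgebraicComplexity

namespace TraceGadget

universe u u'

variable {S : Type u} [CommRing S] {t : ℕ} [NeZero t] {c : Fin t → S} {δ : S}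

variable (t) in
/-- The diagonal entry `(XYZ)ᵢᵢ = Σ_{μ,ν} x_{iμ} y_{μν} z_{νi}`. [cite: Andrews2022, Lemma 8] -/
def diagXYZ (i : Fin t) : MvPolynomial (Var t) S :=
  ∑ μ : Fin t, ∑ ν : Fin t,
    X (Sum.inl (i, μ)) * X (Sum.inr (Sum.inl (μ, ν))) * X (Sum.inr (Sum.inr (ν, i)))

variable (S t) in
/-- The trace `tr(XYZ) = Σᵢ (XYZ)ᵢᵢ` of the product of the three variable matrices (the polynomial
computed by the layered trace ABP on `4t` vertices). [cite: Andrews2022, Lemma 8] -/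
def traceXYZ : MvPolynomial (Var t) S :=
  ∑ i : Fin t, diagXYZ t i

/-! ### Change of scalars -/

omit [NeZero t] in
/-- `tr(XYZ)` has integer coefficients: it is fixed by every change of scalars. [cite: Andrews2022, Lemma 8] -/
theorem map_traceXYZ {S' : Type u'} [CommRing S'] (φ : S →+* S') :
    MvPolynomial.map φ (traceXYZ S t) = traceXYZ S' t := by
  simp [traceXYZ, diagXYZ, map_sum, map_mul, map_X]

/-- Change of scalars in the leading minors of the gadget. [cite: Andrews2022, Lemma 8] -/
theorem map_det_M {S' : Type u'} [CommRing S'] (φ : S →+* S') (k : ℕ) :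
    MvPolynomial.map φ (M t c δ k).det = (M t (φ ∘ c) (φ δ) k).det := by
  rw [RingHom.map_det, RingHom.mapMatrix_apply]
  congr 1
  ext x y
  simp [M, map_gad]

/-- Change of scalars in the product of leading minors over a multiset of sizes.
[cite: Andrews2022, Lemma 8] -/
theorem map_prod_det_M {S' : Type u'} [CommRing S'] (φ : S →+* S') (σ : Multiset ℕ) :
    MvPolynomial.map φ (σ.map fun s => (M t c δ s).det).prod =
      (σ.map fun s => (M t (φ ∘ c) (φ δ) s).det).prod := by
  rw [map_multiset_prod, Multiset.map_map]
  exact congrArg Multiset.prod (Multiset.map_congr rfl fun s _ => map_det_M φ s)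

/-! ### Block bookkeeping -/

/-- The block index of `t·b + x` (`x < t`) is `b`. [folklore] -/
theorem mul_add_div_eq (b : ℕ) {x : ℕ} (hx : x < t) : (t * b + x) / t = b := by
  rw [Nat.mul_add_div (Nat.pos_of_ne_zero (NeZero.ne t)), Nat.div_eq_of_lt hx, add_zero]

/-- `modFin` of an element of `Fin t`. [folklore] -/
@[simp] theorem modFin_val (μ : Fin t) : modFin t (μ : ℕ) = μ :=
  Fin.ext (Nat.mod_eq_of_lt μ.2)

/-- `modFin` is invariant under adding `t`. [folklore] -/
@[simp] theorem modFin_self_add (x : ℕ) : modFin t (t + x) = modFin t x :=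
  Fin.ext (by simp [modFin])

/-- **Summation over one block**: a function on `Fin k` supported in block `b ⊆ [0, k)` is summed
over the offsets `μ < t`. [folklore] -/
theorem sum_block {N : Type u'} [AddCommMonoid N] {k : ℕ} (b : ℕ) (hb : t * b + t ≤ k)
    (f : Fin k → N) (hf : ∀ z : Fin k, (z : ℕ) / t ≠ b → f z = 0) :
    ∑ z, f z = ∑ μ : Fin t, f ⟨t * b + μ, by omega⟩ := by
  classical
  let e : Fin t ↪ Fin k := ⟨fun μ => ⟨t * b + μ, by omega⟩, fun μ ν h => by
    simp only [Fin.mk.injEq] at h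
    exact Fin.ext (by omega)⟩
  have hsub : (Finset.univ.map e) ⊆ Finset.univ := Finset.subset_univ _
  rw [← Finset.sum_subset hsub, Finset.sum_map]
  · rfl
  · intro z _ hz
    refine hf z fun hzb => hz ?_
    rw [Finset.mem_map]
    refine ⟨⟨(z : ℕ) % t, Nat.mod_lt _ (Nat.pos_of_ne_zero (NeZero.ne t))⟩, Finset.mem_univ _,
      Fin.ext ?_⟩
    simp only [e, Function.Embedding.coeFn_mk]
    have := Nat.div_add_mod (z : ℕ) t
    rw [hzb] at this
    omega

/-! ### Entries of `A` -/

/-- `A_{x,y}` when `y` is in the block after `x`'s. [cite: Andrews2022, Lemma 8 (proof)] -/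
theorem upper_eq_lab {x y : ℕ} (h1 : y / t = x / t + 1) (h2 : y < 4 * t) :
    upper t c x y = lab t c (x / t) x y :=
  if_pos ⟨h1, h2⟩

/-- `A_{x,y} = 0` otherwise. [cite: Andrews2022, Lemma 8 (proof)] -/
theorem upper_eq_zero {x y : ℕ} (h : y / t ≠ x / t + 1) : upper t c x y = 0 :=
  if_neg fun h' => h h'.1

/-- The entry `A_{sᵢ, (1,μ)} = cᵢ x_{iμ}` (edges out of the sources). [cite: Andrews2022, Lemma 8 (proof)] -/
theorem A_apply_block01 {k : ℕ} (x : Fin k) (hx : (x : ℕ) < t) (μ : Fin t) (h : t * 1 + t ≤ k) :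
    A t c k x ⟨t * 1 + μ, by omega⟩ = C (c ⟨x, hx⟩) * X (Sum.inl (⟨x, hx⟩, μ)) := by
  have hx0 : (x : ℕ) / t = 0 := Nat.div_eq_of_lt hx
  simp only [A, Matrix.of_apply]
  rw [upper_eq_lab (by rw [mul_add_div_eq 1 μ.2, hx0]) (by omega), hx0]
  simp [lab, modFin_of_lt hx]

/-- The entry `A_{(1,μ),(2,ν)} = y_{μν}`. [cite: Andrews2022, Lemma 8 (proof)] -/
theorem A_apply_block12 {k : ℕ} (μ ν : Fin t) (h1 : t * 1 + t ≤ k) (h2 : t * 2 + t ≤ k) :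
    A t c k ⟨t * 1 + μ, by omega⟩ ⟨t * 2 + ν, by have := h2; omega⟩ = X (Sum.inr (Sum.inl (μ, ν))) := by
  simp only [A, Matrix.of_apply]
  rw [upper_eq_lab (by rw [mul_add_div_eq 1 μ.2, mul_add_div_eq 2 ν.2]) (by omega),
    mul_add_div_eq 1 μ.2]
  simp [lab]

/-- The entry `A_{(2,ν), tᵢ} = z_{νi}` (edges into the sinks). [cite: Andrews2022, Lemma 8 (proof)] -/
theorem A_apply_block23 {k : ℕ} (ν : Fin t) (x : Fin k) (hx : (x : ℕ) < t) (h2 : t * 2 + t ≤ k)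
    (h3 : (x : ℕ) + 3 * t < k) :
    A t c k ⟨t * 2 + ν, by have := h2; omega⟩ ⟨x + 3 * t, h3⟩ =
      X (Sum.inr (Sum.inr (ν, ⟨x, hx⟩))) := by
  have hx3 : ((x : ℕ) + 3 * t) = t * 3 + x := by ring
  simp only [A, Matrix.of_apply]
  rw [upper_eq_lab (by rw [mul_add_div_eq 2 ν.2, hx3, mul_add_div_eq 3 hx]) (by omega),
    mul_add_div_eq 2 ν.2, hx3]
  simp [lab, modFin_of_lt hx]

/-- **Paths of length three**: `(A³)_{sᵢ,tᵢ} = cᵢ (XYZ)ᵢᵢ`. [cite: Andrews2022, Lemma 8 (proof)] -/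
theorem A_pow_three_apply {k : ℕ} (x : Fin k) (hx : (x : ℕ) < t) (h3 : (x : ℕ) + 3 * t < k) :
    (A t c k ^ 3) x ⟨x + 3 * t, h3⟩ = C (c ⟨x, hx⟩) * diagXYZ t ⟨x, hx⟩ := by
  have hx0 : (x : ℕ) / t = 0 := Nat.div_eq_of_lt hx
  have hx3 : ((x : ℕ) + 3 * t) / t = 3 := by
    rw [show (x : ℕ) + 3 * t = t * 3 + x by ring, mul_add_div_eq 3 hx]
  have hk1 : t * 1 + t ≤ k := by omega
  have hk2 : t * 2 + t ≤ k := by omega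
  rw [pow_three', Matrix.mul_apply]
  -- the last intermediate vertex lies in block 2
  rw [sum_block 2 hk2 _ fun z hz => ?_]
  swap
  · rw [show A t c k z ⟨(x : ℕ) + 3 * t, h3⟩ = 0 from upper_eq_zero (by
        simp only
        rw [hx3]
        omega), mul_zero]
  -- the first intermediate vertex lies in block 1
  have hinner : ∀ ν : Fin t, (A t c k * A t c k) x ⟨t * 2 + ν, by omega⟩ =
      ∑ μ : Fin t, C (c ⟨x, hx⟩) * X (Sum.inl (⟨x, hx⟩, μ)) * X (Sum.inr (Sum.inl (μ, ν))) := by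
    intro ν
    rw [Matrix.mul_apply, sum_block 1 hk1 _ fun z hz => ?_]
    swap
    · rw [show A t c k x z = 0 from upper_eq_zero (by rw [hx0]; omega), zero_mul]
    refine Finset.sum_congr rfl fun μ _ => ?_
    rw [A_apply_block01 x hx μ hk1, A_apply_block12 μ ν hk1 hk2]
  simp_rw [hinner, A_apply_block23 _ x hx hk2 h3]
  rw [diagXYZ, Finset.mul_sum]
  simp_rw [Finset.mul_sum, Finset.sum_mul]
  rw [Finset.sum_comm]
  exact Finset.sum_congr rfl fun μ _ => Finset.sum_congr rfl fun ν _ => by ring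

/-- **The relevant entries of `Q = (1 + A)⁻¹`**: `Q_{sᵢ,tᵢ} = -cᵢ (XYZ)ᵢᵢ`.
[cite: Andrews2022, Lemma 8 (proof)] -/
theorem Q_apply_feedback {k : ℕ} (x : Fin k) (hx : (x : ℕ) < t) (h3 : (x : ℕ) + 3 * t < k) :
    Q t c k x ⟨x + 3 * t, h3⟩ = -(C (c ⟨x, hx⟩) * diagXYZ t ⟨x, hx⟩) := by
  have ht : 0 < t := Nat.pos_of_ne_zero (NeZero.ne t)
  have hx0 : (x : ℕ) / t = 0 := Nat.div_eq_of_lt hx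
  have hx3 : ((x : ℕ) + 3 * t) / t = 3 := by
    rw [show (x : ℕ) + 3 * t = t * 3 + x by ring, mul_add_div_eq 3 hx]
  have hne : x ≠ ⟨x + 3 * t, h3⟩ := by
    intro h
    have := congrArg Fin.val h
    simp only at this
    omega
  have h1 : A t c k x ⟨x + 3 * t, h3⟩ = 0 := upper_eq_zero (by
    simp only
    rw [hx3, hx0]
    norm_num)
  have h2 : (A t c k ^ 2) x ⟨x + 3 * t, h3⟩ = 0 := by
    by_contra h
    have := A_pow_apply_ne_zero 2 x _ h
    simp only at this
    rw [hx3, hx0] at this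
    omega
  rw [Q, Matrix.sub_apply, Matrix.add_apply, Matrix.sub_apply, Matrix.one_apply_ne hne, h1, h2,
    A_pow_three_apply x hx h3]
  ring

/-- **The first-order coefficient**: `tr(Q B) = -Σ_{i : 3t + i < k} cᵢ (XYZ)ᵢᵢ` (one term per
feedback edge `tᵢ → sᵢ` inside the `k × k` corner). [cite: Andrews2022, Lemma 8 (proof)] -/
theorem trace_Q_mul_B (k : ℕ) : Matrix.trace (Q t c k * B S t k) =
    ∑ i : Fin t, if (i : ℕ) + 3 * t < k then -(C (c i) * diagXYZ t i) else 0 := by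
  classical
  have ht : 0 < t := Nat.pos_of_ne_zero (NeZero.ne t)
  -- the diagonal of `Q B`
  have hdiag : ∀ x : Fin k, (Q t c k * B S t k) x x =
      if (x : ℕ) < t ∧ (x : ℕ) + 3 * t < k then
        -(C (c (modFin t x)) * diagXYZ t (modFin t x)) else 0 := by
    intro x
    rw [Matrix.mul_apply]
    split_ifs with h
    · rw [Finset.sum_eq_single ⟨(x : ℕ) + 3 * t, h.2⟩]
      · rw [Q_apply_feedback x h.1 h.2, ← modFin_of_lt h.1]
        simp [B, feedback, h.1]
      · intro y _ hy
        have : feedback S t (y : ℕ) (x : ℕ) = 0 := by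
          unfold feedback
          rw [if_neg]
          rintro ⟨hyx, -⟩
          exact hy (Fin.ext hyx)
        simp [B, this]
      · simp
    · refine Finset.sum_eq_zero fun y _ => ?_
      have : feedback S t (y : ℕ) (x : ℕ) = 0 := by
        unfold feedback
        rw [if_neg]
        rintro ⟨hyx, hxt⟩
        exact h ⟨hxt, by have := y.2; omega⟩
      simp [B, this]
  unfold Matrix.trace
  simp_rw [Matrix.diag_apply, hdiag]
  by_cases hk : t ≤ k
  · have hb : t * 0 + t ≤ k := by omega
    rw [sum_block 0 hb _ fun z hz => ?_]
    swap
    · rw [if_neg]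
      rintro ⟨hzt, -⟩
      exact hz (Nat.div_eq_of_lt hzt)
    refine Finset.sum_congr rfl fun μ _ => ?_
    simp only [mul_zero, zero_add, Fin.is_lt, true_and, modFin_val]
  · have h1 : ∀ x : Fin k, ¬((x : ℕ) < t ∧ (x : ℕ) + 3 * t < k) := by
      rintro x ⟨-, h⟩
      omega
    have h2 : ∀ i : Fin t, ¬((i : ℕ) + 3 * t < k) := fun i h => by omega
    simp [h1, h2]

/-! ### Products of first-order expansions -/

/-- `∏ (1 + d aᵢ + d² rᵢ) = 1 + d Σ aᵢ + d² r`. [folklore] -/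
theorem multiset_prod_one_add {R : Type u'} [CommRing R] {ι : Type u} (d : R) (m : Multiset ι)
    (f a : ι → R) (h : ∀ i ∈ m, ∃ r, f i = 1 + d * a i + d ^ 2 * r) :
    ∃ r, (m.map f).prod = 1 + d * (m.map a).sum + d ^ 2 * r := by
  induction m using Multiset.induction_on with
  | empty => exact ⟨0, by simp⟩
  | cons i m ih =>
    obtain ⟨r, hr⟩ := ih fun j hj => h j (Multiset.mem_cons_of_mem hj)
    obtain ⟨ri, hri⟩ := h i (Multiset.mem_cons_self i m)
    refine ⟨ri + r + a i * (m.map a).sum + d * (a i * r + ri * (m.map a).sum) + d ^ 2 * (ri * r), ?_⟩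
    rw [Multiset.map_cons, Multiset.prod_cons, Multiset.map_cons, Multiset.sum_cons, hr, hri]
    ring

/-- Summing an indicator over a multiset counts. [folklore] -/
theorem multiset_sum_map_ite {ι : Type u'} {N : Type u} [AddCommMonoid N] (m : Multiset ι)
    (P : ι → Prop) [DecidablePred P] (v : N) :
    (m.map fun s => if P s then v else 0).sum = (m.filter P).card • v := by
  induction m using Multiset.induction_on with
  | empty => simp
  | cons a m ih =>
    by_cases h : P a
    · rw [Multiset.map_cons, Multiset.sum_cons, ih, Multiset.filter_cons_of_pos _ h,
        Multiset.card_cons, add_smul, one_smul, if_pos h, add_comm]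
    · rw [Multiset.map_cons, Multiset.sum_cons, ih, Multiset.filter_cons_of_neg _ h, if_neg h,
        zero_add]

/-- Swapping a multiset sum with a finite sum. [folklore] -/
theorem multiset_sum_map_finset_sum {ι : Type u'} {κ : Type u} {N : Type*} [AddCommMonoid N]
    (m : Multiset ι) (u : Finset κ) (g : ι → κ → N) :
    (m.map fun s => ∑ i ∈ u, g s i).sum = ∑ i ∈ u, (m.map fun s => g s i).sum := by
  induction m using Multiset.induction_on with
  | empty => simp
  | cons a m ih => simp [ih, Finset.sum_add_distrib]

/-- **Andrews 2022, Lemma 8, for `tr(XYZ)` (`m = 3`, blocks of size `t`, identity padding).**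
Let `σ` be a multiset of corner sizes and suppose the rescaling constants satisfy
`#{s ∈ σ : 3t + i < s} · cᵢ = -1` for all `i < t` (possible whenever `max σ ≥ 4t` and these
positive integers are invertible in `S`, e.g. in characteristic zero). Then the product of the
leading principal minors of the gadget over `σ` is `1 + δ · tr(XYZ) + δ² · R` for some polynomial
`R`. [cite: Andrews2022, Lemma 8] -/
theorem prod_det_M (σ : Multiset ℕ)
    (hc : ∀ i : Fin t, ((σ.filter fun s => (i : ℕ) + 3 * t < s).card : S) * c i = -1) :
    ∃ R : MvPolynomial (Var t) S,
      (σ.map fun s => (M t c δ s).det).prod = 1 + C δ * traceXYZ S t + C δ ^ 2 * R := by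
  classical
  obtain ⟨R, hR⟩ := multiset_prod_one_add (C δ) σ (fun s => (M t c δ s).det)
    (fun s => Matrix.trace (Q t c s * B S t s)) fun s _ => det_M_eq s
  refine ⟨R, ?_⟩
  have key : (σ.map fun s => Matrix.trace (Q t c s * B S t s)).sum = traceXYZ S t := by
    simp_rw [trace_Q_mul_B]
    rw [multiset_sum_map_finset_sum, traceXYZ]
    refine Finset.sum_congr rfl fun i _ => ?_
    rw [multiset_sum_map_ite, nsmul_eq_mul, ← map_natCast (C : S →+* MvPolynomial (Var t) S),
      mul_neg, ← mul_assoc, ← map_mul, hc i]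
    simp
  rw [hR, key]

end TraceGadget

end Literature.Computability.AlgebraicComplexity
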